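import Summits.QuantumFields.BalabanUV.T4Continuum.Spine.NE7.NodeSAtDatumOfRecordNearSupport

/-!
# Spine/NE7/NodeSChainAtDatumOfRecord — NODE S's chain END TO END at NODE 00's datum of record (Stage 0), with the NEAR-SUPPORT count:
# for ANY two probability laws on level-`k` configurations in `dom`, trivial off `Λ`, the `t`-discrepancy of the log of the rider-tilted
# integrals of the datum's OWN `n`-fold averages is `≤ 2|t|·(e²∕2)·(|w|·|Λ_near|·Dm)²·(θ²)ⁿ`

Cell `pub-balaban-gaps` (YM blitz Y1, track G2, seat `ne7`, generation 13).  50th `Spine/NE7/` file; 0 `def`, 0 sorry; [bookkeeping].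
File 29's `abs_log_quotient_sub_le_blockAvgSU` is NODE S's chain end to end for the printed prescription (0.4) with the FULL support count
`|Λ|`; files 41∕47∕48 localise the defect to the near-support `Λ_near` (bonds within `ℓ¹`-distance `(d+2)(L^{k+n} − L^k)`, finest lattice, of a
loop step's source centre) at the datum predicate `Node00.IsDatumOfRecord₀`.  This file composes the two: at every datum of record `D`, cutoff
`K`, levels `k + n ≤ m + K`, closed walk `(x, w)`, for every pair of probability laws `ν₁, ν₂` on a space `Ω` read into level-`k` configurations
`cfg ω ∈ dom` trivial off `Λ` with one-bond deviations `≤ Dm`, and every `t`: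
`|log ∫ e^{t(W−1)} dν₁ − log ∫ e^{t(W−1)} dν₂| ≤ 2·(|t|·(½e²·(|w|·|Λ_near|·Dm)²·(θ²)ⁿ))`, `W = loopAt (iterFrom (D.av K) k n (cfg ω)) (walk x w)`
— the per-entry W-fmt@1 bound `s ≤ Cd·wt·(θ^{K−j})²` of files 36∕44's END FACE with `wt ∝ (|w|·|Λ_near|·Dm)²`, at the object node's predicate.
No property of the laws beyond the support is used (criticality: the first order is absent at `U = 1`).

HONEST FRAMING.  [bookkeeping] composition of `QLaCriticality.abs_log_integral_exp_sub_le` with file 48; Stage 0 constrains only `D.av`; the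
two laws, `Λ`, `Dm` are the object node's W-fmt data (Stage 5), hypotheses here.  NE7 NOT proved; spine 0∕9; one finite T⁴ — NOT ℝ⁴, NOT
infinite volume, NOT a mass gap, NOT Clay.  No word moves (R10).
-/

noncomputable section

open MeasureTheory

namespace Summit.QuantumFields.BalabanUV.T4Continuum.Spine.NE7

open Literature.MathematicalPhysics.QuantumFieldTheory.Balaban1983to89
open Literature.MathematicalPhysics.QuantumFieldTheory.Balaban1983to89.T4Continuum
open Literature.MathematicalPhysics.QuantumFieldTheory.Balaban1983to89.T4Continuum.FiniteEpsData
open Literature.MathematicalPhysics.QuantumFieldTheory.Balaban1983to89.T4AvgSensitivity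
open Literature.MathematicalPhysics.QuantumFieldTheory.Balaban1983to89.T4AvgDerivBound
open Literature.MathematicalPhysics.QuantumFieldTheory.Balaban1983to89.B15DeterminingSets (embIter)
open Literature.MathematicalPhysics.QuantumFieldTheory.Balaban1983to89.Node00 (IsDatumOfRecord₀)

variable {F : T4Family} {N : ℕ} [NeZero N]

open Classical in
/-- **NODE S's CHAIN END TO END AT THE DATUM OF RECORD, NEAR-SUPPORT COUNT.**  See the module docstring; `Λ_near` is characterised by `hΛD`.
(`QLaCriticality.abs_log_integral_exp_sub_le` ∘ file 48's `loopDefect_le_of_near_support_of_isDatumOfRecord₀` ∘ `loopDefect_nonneg`.) [bookkeeping] -/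
theorem abs_log_quotient_sub_le_of_isDatumOfRecord₀ (D : FiniteEpsData F (Matrix.specialUnitaryGroup (Fin N) ℂ))
    (hD : IsDatumOfRecord₀ F N D) (K : ℕ) {k n : ℕ} (hn : k + n ≤ (F.P K).m + (F.P K).K)
    (x : Site (F.P K) (k + n)) (w : List (Letter (F.P K).d)) (hw : walkEnd x w = x)
    {Ω : Type*} [MeasurableSpace Ω] (ν₁ ν₂ : Measure Ω) [IsProbabilityMeasure ν₁] [IsProbabilityMeasure ν₂]
    (cfg : Ω → GaugeField (F.P K) k (Matrix.specialUnitaryGroup (Fin N) ℂ)) (hdom : ∀ ω, cfg ω ∈ dom (F.P K) (Fin N) k)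
    (Λ ΛD : Finset (PBond (F.P K) k))
    (hΛD : ∀ b, b ∈ ΛD ↔ b ∈ Λ ∧ ∃ s ∈ walk x w,
      Site.tdist (embIter k b.src) (embIter (k + n) s.bond.src)
        ≤ ((F.P K).d + 2) * ((F.P K).L ^ (k + n) - (F.P K).L ^ k))
    {Dm : ℝ} (hoff : ∀ ω b, b ∉ Λ → cfg ω b = 1) (hDm : ∀ ω, ∀ b ∈ Λ, dist1 (cfg ω b) ≤ Dm)
    (hG₁ : AEStronglyMeasurable (fun ω => loopAt (iterFrom (D.av K) k n (cfg ω)) (walk x w) - 1) ν₁)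
    (hG₂ : AEStronglyMeasurable (fun ω => loopAt (iterFrom (D.av K) k n (cfg ω)) (walk x w) - 1) ν₂) (t : ℝ) :
    |Real.log (∫ ω, Real.exp (t * (loopAt (iterFrom (D.av K) k n (cfg ω)) (walk x w) - 1)) ∂ν₁)
      - Real.log (∫ ω, Real.exp (t * (loopAt (iterFrom (D.av K) k n (cfg ω)) (walk x w) - 1)) ∂ν₂)|
      ≤ 2 * (|t| * (1 / 2 * Real.exp 1 ^ 2 * ((w.length : ℝ) * ΛD.card * Dm) ^ 2 * (theta (F.P K) ^ 2) ^ n)) := by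
  have key : ∀ ω, |loopAt (iterFrom (D.av K) k n (cfg ω)) (walk x w) - 1|
      ≤ 1 / 2 * Real.exp 1 ^ 2 * ((w.length : ℝ) * ΛD.card * Dm) ^ 2 * (theta (F.P K) ^ 2) ^ n := fun ω => by
    have h := loopDefect_le_of_near_support_of_isDatumOfRecord₀ D hD K hn x w hw (cfg ω) (hdom ω) Λ ΛD hΛD
      (fun b hb => hoff ω b hb) (hDm ω)
    have h0 := loopDefect_nonneg (iterFrom (D.av K) k n (cfg ω)) (walk x w)
    rw [abs_le]
    constructor <;> linarith
  exact abs_log_integral_exp_sub_le ν₁ ν₂ hG₁ hG₂ (ae_of_all _ key) (ae_of_all _ key) t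

open Classical in
/-- The same END statement keyed to files 36∕44's END-FACE binders: the defect size `s := Cd·wt·(θ^n)²` with `Cd = ½e²` and
`wt = (|w|·|Λ_near|·Dm)²` satisfies `|G| ≤ s` a.e. for BOTH laws — i.e. the hypotheses `hb₁`∕`hb₂` of `QLaCensus.qla_of_logQuotient` ∕
`QLaCensusTorusMultiplicity.qla_of_torusTreeDecay` for this entry, at the datum of record. [bookkeeping] -/
theorem rider_defect_ae_le_of_isDatumOfRecord₀ (D : FiniteEpsData F (Matrix.specialUnitaryGroup (Fin N) ℂ))
    (hD : IsDatumOfRecord₀ F N D) (K : ℕ) {k n : ℕ} (hn : k + n ≤ (F.P K).m + (F.P K).K)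
    (x : Site (F.P K) (k + n)) (w : List (Letter (F.P K).d)) (hw : walkEnd x w = x)
    {Ω : Type*} [MeasurableSpace Ω] (ν : Measure Ω)
    (cfg : Ω → GaugeField (F.P K) k (Matrix.specialUnitaryGroup (Fin N) ℂ)) (hdom : ∀ ω, cfg ω ∈ dom (F.P K) (Fin N) k)
    (Λ ΛD : Finset (PBond (F.P K) k))
    (hΛD : ∀ b, b ∈ ΛD ↔ b ∈ Λ ∧ ∃ s ∈ walk x w,
      Site.tdist (embIter k b.src) (embIter (k + n) s.bond.src)
        ≤ ((F.P K).d + 2) * ((F.P K).L ^ (k + n) - (F.P K).L ^ k))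
    {Dm : ℝ} (hoff : ∀ ω b, b ∉ Λ → cfg ω b = 1) (hDm : ∀ ω, ∀ b ∈ Λ, dist1 (cfg ω b) ≤ Dm) :
    ∀ᵐ ω ∂ν, |loopAt (iterFrom (D.av K) k n (cfg ω)) (walk x w) - 1|
      ≤ 1 / 2 * Real.exp 1 ^ 2 * ((w.length : ℝ) * ΛD.card * Dm) ^ 2 * (theta (F.P K) ^ n) ^ 2 := by
  refine ae_of_all _ fun ω => ?_
  have h := loopDefect_le_of_near_support_of_isDatumOfRecord₀ D hD K hn x w hw (cfg ω) (hdom ω) Λ ΛD hΛD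
    (fun b hb => hoff ω b hb) (hDm ω)
  have h0 := loopDefect_nonneg (iterFrom (D.av K) k n (cfg ω)) (walk x w)
  have e : (theta (F.P K) ^ n) ^ 2 = (theta (F.P K) ^ 2) ^ n := by ring
  rw [e, abs_le]
  constructor <;> linarith

end Summit.QuantumFields.BalabanUV.T4Continuum.Spine.NE7

end
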